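import Mathlib

/-!
# `MirrorModularBoosts.CurvatureBoostCovariance`, line `boosts-inherit-mirrors`: THE PARITY SIEVE (the lever (ii))

Support file for crux `stmt-QuantumFields-9663`
(`Summit.QuantumFields.YangMills.Theses.MirrorModularBoosts.CurvatureBoostCovariance`), line `boosts-inherit-mirrors`:
the PROVED lever (ii) of the line, extracted verbatim from the checked skeleton
`Cruxes/CurvatureBoostCovariance/Lines/boosts_inherit_mirrors.lean` (planner crux-plan round 1; registered by the lead as
`stub_paritySieve` so that it lives in `Theorems/` and the eventual crux file stays within size).  Pure algebra over Mathlib.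

**The parity sieve.**  A 2×2 Laurent pencil `[[P,Q],[Q',R]](s)`, `P = Σ p_k s^k` etc., that is positive semidefinite for
EVERY real `s ≠ 0` (both half-lines: in the line, `s > 0` are the axis rays and `s < 0` the diagonal rays of the complexified
rotation angle) and whose diagonal entries have no layer `|k| ≥ 2`, has constant off-diagonal entry: `q_k = 0` for `k ≠ 0`.
Proof: `P(s) = p₋₁/s + p₀ + p₁ s` is real and `≥ 0` on `ℝ∖0`; PARITY `P(s) + P(-s) = 2p₀` bounds it, and a bounded Laurent
polynomial is constant (`laurent_bounded_const`, via the top coefficient `top_coeff_zero` and the reflection `laurent_reflect`);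
same for `R`; `Im z = 0` for all `v, w` gives `Q' = Q̄`; the 2×2 PSD condition gives `|Q(s)|² ≤ r₀(1 + p₀)`
(`hermitian_bound`), so `Q` is bounded, hence constant.  This is the idea card's `OddTopHarmonicVanishes` with its two
decorative hypotheses removed (Disproof §7, TRIAGE r1-1/2/3) and the Cauchy–Schwarz interlacing folded in.
References: folklore (Laurent polynomials; positive semidefinite 2×2 Hermitian forms).
-/

noncomputable section

namespace Summit.QuantumFields.YangMills.Theorems.CurvatureBoostCovariance.BoostsInheritMirrors

open scoped BigOperators ComplexConjugate
open Filter Topology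

namespace Sieve

open scoped ComplexConjugate

/-- Top coefficient of a Laurent polynomial bounded on `[1, ∞)` vanishes. -/
theorem top_coeff_zero (a K : ℤ) (hK : 0 < K) (haK : a ≤ K) (c : ℤ → ℂ) (M : ℝ)
    (hb : ∀ s : ℝ, 1 ≤ s → ‖∑ k ∈ Finset.Icc a K, c k * (s : ℂ) ^ k‖ ≤ M) : c K = 0 := by
  set g : ℝ → ℂ := fun s => (∑ k ∈ Finset.Icc a K, c k * (s : ℂ) ^ k) * (s : ℂ) ^ (-K) with hg
  have h1 : Tendsto g atTop (𝓝 (c K)) := by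
    have hev : g =ᶠ[atTop] fun s => ∑ k ∈ Finset.Icc a K, c k * (s : ℂ) ^ (k - K) := by
      filter_upwards [eventually_ge_atTop (1 : ℝ)] with s hs
      have hs0 : (s : ℂ) ≠ 0 := by exact_mod_cast (by linarith : s ≠ 0)
      simp only [hg, Finset.sum_mul]
      refine Finset.sum_congr rfl fun k _ => ?_
      rw [mul_assoc, ← zpow_add₀ hs0, sub_eq_add_neg]
    refine Tendsto.congr' hev.symm ?_
    have hlim : ∀ k ∈ Finset.Icc a K,
        Tendsto (fun s : ℝ => c k * (s : ℂ) ^ (k - K)) atTop (𝓝 (if k = K then c K else 0)) := by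
      intro k hk
      by_cases hkK : k = K
      · subst hkK; simp
      · have hneg : k - K < 0 := by
          have := (Finset.mem_Icc.mp hk).2
          omega
        simp only [hkK, if_false]
        have h0 : Tendsto (fun s : ℝ => (s : ℂ) ^ (k - K)) atTop (𝓝 0) := by
          have hr : Tendsto (fun s : ℝ => s ^ (k - K)) atTop (𝓝 0) := tendsto_zpow_atTop_zero hneg
          have := (Complex.continuous_ofReal.tendsto 0).comp hr
          simpa [Function.comp_def, Complex.ofReal_zpow] using this
        simpa using (tendsto_const_nhds (x := c k)).mul h0
    have := tendsto_finsetSum (Finset.Icc a K) hlim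
    simpa [Finset.sum_ite_eq', Finset.mem_Icc, haK, le_refl, hK.le] using this
  have h2 : Tendsto g atTop (𝓝 0) := by
    have hbound : ∀ᶠ s in atTop, ‖g s‖ ≤ M * s ^ (-K) := by
      filter_upwards [eventually_ge_atTop (1 : ℝ)] with s hs
      have hs0 : (0 : ℝ) < s := by linarith
      rw [hg, norm_mul, norm_zpow, Complex.norm_real, Real.norm_of_nonneg hs0.le]
      exact mul_le_mul_of_nonneg_right (hb s hs) (zpow_nonneg hs0.le _)
    have hM : Tendsto (fun s : ℝ => M * s ^ (-K)) atTop (𝓝 0) := by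
      simpa using (tendsto_zpow_atTop_zero (by omega : -K < 0)).const_mul M
    exact squeeze_zero_norm' hbound hM
  exact tendsto_nhds_unique h1 h2

/-- Reflection `k ↦ -k` of a symmetric-range Laurent polynomial is evaluation at `s⁻¹`. -/
theorem laurent_reflect (K : ℕ) (c : ℤ → ℂ) (s : ℂ) :
    ∑ k ∈ Finset.Icc (-(K : ℤ)) K, c (-k) * s ^ k = ∑ k ∈ Finset.Icc (-(K : ℤ)) K, c k * s⁻¹ ^ k := by
  refine Finset.sum_equiv (Equiv.neg ℤ) (fun k => ?_) (fun k _ => ?_)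
  · simp only [Finset.mem_Icc, Equiv.neg_apply]
    omega
  · rw [Equiv.neg_apply, inv_zpow', neg_neg]

/-- A Laurent polynomial bounded on `ℝ∖0` is constant. -/
theorem laurent_bounded_const (K : ℕ) (c : ℤ → ℂ) (M : ℝ)
    (hb : ∀ s : ℝ, s ≠ 0 → ‖∑ k ∈ Finset.Icc (-(K : ℤ)) K, c k * (s : ℂ) ^ k‖ ≤ M) :
    ∀ k ∈ Finset.Icc (-(K : ℤ)) K, k ≠ 0 → c k = 0 := by
  induction K with
  | zero =>
    intro k hk hk0
    simp only [CharP.cast_eq_zero, neg_zero, Finset.Icc_self, Finset.mem_singleton] at hk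
    exact absurd hk hk0
  | succ K ih =>
    -- top coefficient
    have htop : c ((K : ℤ) + 1) = 0 := by
      refine top_coeff_zero (-((K : ℤ) + 1)) ((K : ℤ) + 1) (by omega) (by omega) c M fun s hs => ?_
      have := hb s (by linarith)
      simpa using this
    -- bottom coefficient, by reflection `s ↦ s⁻¹`
    have hbot : c (-((K : ℤ) + 1)) = 0 := by
      have := top_coeff_zero (-((K : ℤ) + 1)) ((K : ℤ) + 1) (by omega) (by omega) (fun k => c (-k)) M
        fun s hs => ?_
      · simpa using this
      · have hs0 : s ≠ 0 := by linarith
        have hrefl := laurent_reflect (K + 1) c (s : ℂ)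
        push_cast at hrefl ⊢
        rw [hrefl]
        have := hb s⁻¹ (inv_ne_zero hs0)
        simpa [Complex.ofReal_inv] using this
    -- reduce to `K`
    have hsub : Finset.Icc (-(K : ℤ)) K ⊆ Finset.Icc (-((K : ℤ) + 1)) ((K : ℤ) + 1) :=
      Finset.Icc_subset_Icc (by omega) (by omega)
    have hK : ∀ k ∈ Finset.Icc (-(K : ℤ)) K, k ≠ 0 → c k = 0 := by
      refine ih fun s hs => ?_
      have heq : ∑ k ∈ Finset.Icc (-(K : ℤ)) K, c k * (s : ℂ) ^ k =
          ∑ k ∈ Finset.Icc (-((K : ℤ) + 1)) ((K : ℤ) + 1), c k * (s : ℂ) ^ k := by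
        refine Finset.sum_subset hsub fun k hk hk' => ?_
        have hk1 : k = (K : ℤ) + 1 ∨ k = -((K : ℤ) + 1) := by
          simp only [Finset.mem_Icc, not_and_or, not_le] at hk hk'
          omega
        rcases hk1 with rfl | rfl
        · rw [htop, zero_mul]
        · rw [hbot, zero_mul]
      rw [heq]
      have := hb s hs
      push_cast at this ⊢
      exact this
    intro k hk hk0
    by_cases hkin : k ∈ Finset.Icc (-(K : ℤ)) K
    · exact hK k hkin hk0
    · have hk1 : k = (K : ℤ) + 1 ∨ k = -((K : ℤ) + 1) := by
        simp only [Finset.mem_Icc, not_and_or, not_le] at hk hkin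
        push_cast at hk
        omega
      rcases hk1 with rfl | rfl
      · exact htop
      · exact hbot

/-- A real non-negative Laurent polynomial on `ℝ∖0` with no layer `|k| ≥ 2` is constant (PARITY). -/
theorem diag_const (K : ℕ) (c : ℤ → ℂ)
    (hpos : ∀ s : ℝ, s ≠ 0 → 0 ≤ (∑ k ∈ Finset.Icc (-(K : ℤ)) K, c k * (s : ℂ) ^ k).re ∧
      (∑ k ∈ Finset.Icc (-(K : ℤ)) K, c k * (s : ℂ) ^ k).im = 0)
    (h2 : ∀ k ∈ Finset.Icc (-(K : ℤ)) K, 2 ≤ |k| → c k = 0) :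
    ∀ k ∈ Finset.Icc (-(K : ℤ)) K, k ≠ 0 → c k = 0 := by
  set f : ℝ → ℂ := fun s => ∑ k ∈ Finset.Icc (-(K : ℤ)) K, c k * (s : ℂ) ^ k with hf
  -- parity: `f s + f (-s) = 2 c 0`
  have h0mem : (0 : ℤ) ∈ Finset.Icc (-(K : ℤ)) K := by simp
  have hpar : ∀ s : ℝ, s ≠ 0 → f s + f (-s) = 2 * c 0 := by
    intro s hs
    have hs0 : (s : ℂ) ≠ 0 := by exact_mod_cast hs
    simp only [hf, ← Finset.sum_add_distrib]
    rw [Finset.sum_eq_single (0 : ℤ) ?_ (fun h => absurd h0mem h)]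
    · simp; ring
    · intro k hk hk0
      by_cases hk2 : 2 ≤ |k|
      · rw [h2 k hk hk2]; simp
      · have hk1 : k = 1 ∨ k = -1 := by
          have := abs_lt.mp (not_le.mp hk2)
          omega
        rcases hk1 with rfl | rfl
        · push_cast
          simp only [zpow_one]
          ring
        · push_cast
          rw [zpow_neg_one, zpow_neg_one, ← mul_add]
          have : (s : ℂ)⁻¹ + (-(s : ℂ))⁻¹ = 0 := by rw [inv_neg]; ring
          rw [this, mul_zero]
  -- bound: `‖f s‖ ≤ ‖2 c 0‖`
  have hbd : ∀ s : ℝ, s ≠ 0 → ‖f s‖ ≤ ‖2 * c 0‖ := by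
    intro s hs
    obtain ⟨hre, him⟩ : 0 ≤ (f s).re ∧ (f s).im = 0 := hpos s hs
    obtain ⟨hre', -⟩ : 0 ≤ (f (-s)).re ∧ (f (-s)).im = 0 := hpos (-s) (neg_ne_zero.mpr hs)
    have hfs : f s = ((f s).re : ℂ) :=
      Complex.ext (Complex.ofReal_re _).symm (by rw [Complex.ofReal_im]; exact him)
    have h1 : ‖f s‖ = (f s).re := by
      rw [hfs, Complex.norm_real, Real.norm_of_nonneg hre, Complex.ofReal_re]
    have h2 : (f s).re + (f (-s)).re = (2 * c 0).re := by
      rw [← Complex.add_re, hpar s hs]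
    calc ‖f s‖ = (f s).re := h1
      _ ≤ (f s).re + (f (-s)).re := le_add_of_nonneg_right hre'
      _ = (2 * c 0).re := h2
      _ ≤ ‖2 * c 0‖ := Complex.re_le_norm _
  exact laurent_bounded_const K c ‖2 * c 0‖ hbd

/-- The 2×2 Hermitian bound: `|b|² ≤ c (1 + a)`. -/
theorem hermitian_bound (a c : ℝ) (ha : 0 ≤ a) (b : ℂ)
    (h : ∀ v w : ℂ, 0 ≤ (conj v * v * (a : ℂ) + conj v * w * b + conj w * v * conj b + conj w * w * (c : ℂ)).re) :
    Complex.normSq b ≤ c * (1 + a) := by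
  set t : ℝ := 1 / (1 + a) with ht
  have h1a : 0 < 1 + a := by linarith
  have htpos : 0 < t := by rw [ht]; positivity
  have hta : t * (1 + a) = 1 := by rw [ht]; field_simp
  have hspec := h (-(t : ℂ) * b) 1
  have hre : (conj (-(t : ℂ) * b) * (-(t : ℂ) * b) * (a : ℂ) + conj (-(t : ℂ) * b) * 1 * b +
      conj (1 : ℂ) * (-(t : ℂ) * b) * conj b + conj (1 : ℂ) * 1 * (c : ℂ)).re =
      t ^ 2 * Complex.normSq b * a - 2 * t * Complex.normSq b + c := by
    simp [Complex.mul_re, Complex.mul_im, Complex.normSq_apply, Complex.conj_re, Complex.conj_im]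
    ring
  rw [hre] at hspec
  have hnb : 0 ≤ Complex.normSq b := Complex.normSq_nonneg b
  have hkey : t * Complex.normSq b ≤ c := by
    have hta1 : t * a ≤ 1 := by nlinarith
    nlinarith [mul_nonneg htpos.le hnb, mul_nonneg (mul_nonneg htpos.le hnb) (sub_nonneg.mpr hta1)]
  calc Complex.normSq b = t * Complex.normSq b * (1 + a) := by rw [mul_comm t, mul_assoc, hta, mul_one]
    _ ≤ c * (1 + a) := mul_le_mul_of_nonneg_right hkey h1a.le

/-- **THE PARITY SIEVE (the lever (ii) of the line; PROVED).**  A 2×2 Laurent pencil `[[P,Q],[Q',R]](s)`,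
`P = Σ p_k s^k` etc., that is positive semidefinite for EVERY real `s ≠ 0` (both half-lines: `s > 0` are the axis
rays, `s < 0` the diagonal rays) and whose diagonal entries have no layer `|k| ≥ 2`, has constant off-diagonal entry:
`q_k = 0` for `k ≠ 0`.  Proof: `P(s) = p₋₁/s + p₀ + p₁ s` is real and `≥ 0` on `ℝ∖0`; PARITY `P(s) + P(-s) = 2p₀`
bounds it, and a bounded Laurent polynomial is constant (`laurent_bounded_const`: the ODD layer changes sign across `0`
— this is where the diagonal mirrors bite); same for `R`; `Im z = 0` for all `v, w` gives `Q' = Q̄` on `ℝ∖0`; the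
2×2 PSD condition gives `|Q(s)|² ≤ r₀(1 + p₀)` (`hermitian_bound`), so `Q` is bounded, hence constant.  This is the
card's `OddTopHarmonicVanishes` with the two decorative hypotheses removed (Disproof §7, TRIAGE r1-1/2/3) and the
Cauchy–Schwarz interlacing folded in. -/
theorem paritySieve :
    ∀ (Kp Kq Kq' Kr : ℕ) (p q q' r : ℤ → ℂ),
      (∀ s : ℝ, s ≠ 0 → ∀ v w : ℂ,
        (fun z : ℂ => 0 ≤ z.re ∧ z.im = 0)
          ((∑ k ∈ Finset.Icc (-(Kp : ℤ)) Kp, starRingEnd ℂ v * v * (p k * (s : ℂ) ^ k)) +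
          (∑ k ∈ Finset.Icc (-(Kq : ℤ)) Kq, starRingEnd ℂ v * w * (q k * (s : ℂ) ^ k)) +
          (∑ k ∈ Finset.Icc (-(Kq' : ℤ)) Kq', starRingEnd ℂ w * v * (q' k * (s : ℂ) ^ k)) +
          (∑ k ∈ Finset.Icc (-(Kr : ℤ)) Kr, starRingEnd ℂ w * w * (r k * (s : ℂ) ^ k)))) →
      (∀ k ∈ Finset.Icc (-(Kp : ℤ)) Kp, 2 ≤ |k| → p k = 0) →
      (∀ k ∈ Finset.Icc (-(Kr : ℤ)) Kr, 2 ≤ |k| → r k = 0) →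
      ∀ k ∈ Finset.Icc (-(Kq : ℤ)) Kq, k ≠ 0 → q k = 0 := by
  intro Kp Kq Kq' Kr p q q' r hpsd hp hr
  -- the four entries of the pencil
  set P : ℝ → ℂ := fun s => ∑ k ∈ Finset.Icc (-(Kp : ℤ)) Kp, p k * (s : ℂ) ^ k with hP
  set Q : ℝ → ℂ := fun s => ∑ k ∈ Finset.Icc (-(Kq : ℤ)) Kq, q k * (s : ℂ) ^ k with hQ
  set Q' : ℝ → ℂ := fun s => ∑ k ∈ Finset.Icc (-(Kq' : ℤ)) Kq', q' k * (s : ℂ) ^ k with hQ'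
  set R : ℝ → ℂ := fun s => ∑ k ∈ Finset.Icc (-(Kr : ℤ)) Kr, r k * (s : ℂ) ^ k with hR
  have hform : ∀ s : ℝ, s ≠ 0 → ∀ v w : ℂ,
      0 ≤ (conj v * v * P s + conj v * w * Q s + conj w * v * Q' s + conj w * w * R s).re ∧
      (conj v * v * P s + conj v * w * Q s + conj w * v * Q' s + conj w * w * R s).im = 0 := by
    intro s hs v w
    have := hpsd s hs v w
    simpa only [hP, hQ, hQ', hR, Finset.mul_sum] using this
  -- (A) the diagonal entries are non-negative real constants
  have hPpos : ∀ s : ℝ, s ≠ 0 → 0 ≤ (P s).re ∧ (P s).im = 0 := by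
    intro s hs; simpa using hform s hs 1 0
  have hRpos : ∀ s : ℝ, s ≠ 0 → 0 ≤ (R s).re ∧ (R s).im = 0 := by
    intro s hs; simpa using hform s hs 0 1
  have hp0 : ∀ k ∈ Finset.Icc (-(Kp : ℤ)) Kp, k ≠ 0 → p k = 0 := diag_const Kp p hPpos hp
  have hr0 : ∀ k ∈ Finset.Icc (-(Kr : ℤ)) Kr, k ≠ 0 → r k = 0 := diag_const Kr r hRpos hr
  have hPc : ∀ s : ℝ, P s = p 0 := by
    intro s
    simp only [hP]
    rw [Finset.sum_eq_single 0 (fun k hk hk0 => by rw [hp0 k hk hk0, zero_mul]) (fun h => absurd (by simp) h)]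
    simp
  have hRc : ∀ s : ℝ, R s = r 0 := by
    intro s
    simp only [hR]
    rw [Finset.sum_eq_single 0 (fun k hk hk0 => by rw [hr0 k hk hk0, zero_mul]) (fun h => absurd (by simp) h)]
    simp
  have hp0re : p 0 = ((p 0).re : ℂ) ∧ 0 ≤ (p 0).re := by
    have := hPpos 1 one_ne_zero
    rw [hPc] at this
    exact ⟨Complex.ext (by simp) (by simp [this.2]), this.1⟩
  have hr0re : r 0 = ((r 0).re : ℂ) ∧ 0 ≤ (r 0).re := by
    have := hRpos 1 one_ne_zero
    rw [hRc] at this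
    exact ⟨Complex.ext (by simp) (by simp [this.2]), this.1⟩
  -- (B) hermiticity of the off-diagonal entries: `Q' = conj Q`
  have hQQ' : ∀ s : ℝ, s ≠ 0 → Q' s = conj (Q s) := by
    intro s hs
    have h11 := (hform s hs 1 1).2
    have h1I := (hform s hs 1 Complex.I).2
    rw [hPc, hRc, hp0re.1, hr0re.1] at h11 h1I
    simp [Complex.mul_im] at h11 h1I
    apply Complex.ext
    · simp; linarith
    · simp; linarith
  -- (C) the 2×2 bound and boundedness of `Q`
  have hbd : ∀ s : ℝ, s ≠ 0 → ‖Q s‖ ≤ 1 + (r 0).re * (1 + (p 0).re) := by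
    intro s hs
    have hnsq : Complex.normSq (Q s) ≤ (r 0).re * (1 + (p 0).re) := by
      refine hermitian_bound (p 0).re (r 0).re hp0re.2 (Q s) fun v w => ?_
      have := (hform s hs v w).1
      rw [hPc, hRc, hQQ' s hs] at this
      rw [← hp0re.1, ← hr0re.1]
      exact this
    have hn : ‖Q s‖ ^ 2 ≤ (r 0).re * (1 + (p 0).re) := by rwa [← Complex.normSq_eq_norm_sq]
    nlinarith [norm_nonneg (Q s), sq_nonneg (‖Q s‖ - 1)]
  exact laurent_bounded_const Kq q _ hbd

end Sieve

/-- **Registered form of the parity sieve** (`stub_paritySieve` of the line's skeleton; the `let z` of `Sieve.paritySieve`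
written as a β-redex, definitionally the same statement). -/
theorem stub_paritySieve :
    ∀ (Kp Kq Kq' Kr : ℕ) (p q q' r : ℤ → ℂ),
      (∀ s : ℝ, s ≠ 0 → ∀ v w : ℂ,
        (fun z : ℂ => 0 ≤ z.re ∧ z.im = 0)
          ((∑ k ∈ Finset.Icc (-(Kp : ℤ)) Kp, starRingEnd ℂ v * v * (p k * (s : ℂ) ^ k)) +
          (∑ k ∈ Finset.Icc (-(Kq : ℤ)) Kq, starRingEnd ℂ v * w * (q k * (s : ℂ) ^ k)) +
          (∑ k ∈ Finset.Icc (-(Kq' : ℤ)) Kq', starRingEnd ℂ w * v * (q' k * (s : ℂ) ^ k)) +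
          (∑ k ∈ Finset.Icc (-(Kr : ℤ)) Kr, starRingEnd ℂ w * w * (r k * (s : ℂ) ^ k)))) →
      (∀ k ∈ Finset.Icc (-(Kp : ℤ)) Kp, 2 ≤ |k| → p k = 0) →
      (∀ k ∈ Finset.Icc (-(Kr : ℤ)) Kr, 2 ≤ |k| → r k = 0) →
      ∀ k ∈ Finset.Icc (-(Kq : ℤ)) Kq, k ≠ 0 → q k = 0 :=
  Sieve.paritySieve

end Summit.QuantumFields.YangMills.Theorems.CurvatureBoostCovariance.BoostsInheritMirrors

end
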